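import Summits.CriticalPhenomena.PercolationContinuityZ3.Theorems.Transplant.SkelWindowSpans
import Summits.CriticalPhenomena.PercolationContinuityZ3.Theorems.Transplant.PlanarCellsNarrowSep
import Summits.CriticalPhenomena.PercolationContinuityZ3.Theorems.Transplant.KNCellsBoxProdZ2ConcG
import Summits.CriticalPhenomena.PercolationContinuityZ3.Theorems.Transplant.KNCells2SepQ
import HarnessLib

/-!
# L3.1 (part 2): the CELL GEOMETRY OF RECORD over a `PlanarSkeletonConc` — Kozma–Nitzan's anchored cells as VERTEX SPANS of coordinate-free
# windows (`SkelWindowSpans`), with p3's general fibre-radius schedule `ConcRadiiG` VERBATIM, the narrow planar boxes of (A2)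
# (`PlanarCellsNarrowDefs/Sep`, hp-8 g22), and the SEVEN geometry records of the generic layer: `RunGeom`, `AnchGeom`, `SepGeom`, `SepGeom₂`,
# `ExitGeom`, `StepsGeom`, `LevelGeom` (+ `QSepGeom`) — the generic twin of `KNCellsBoxProdZ2ConcG` (SHEAR-SCOPE §3.9 L3.1 + L3.2)

builds on p205010 (kernel theorem, internal audit signed; external expert review pending) — nothing in this file uses p205010.
Lane `prim-bschramm-*`, seat `prim-bschramm-p2` (gen 3); helper file (`--supports stmt-CriticalPhenomena-4575`).

DICTIONARY (§p3 3.1 / §p2 2.5): `ballFin X w₀ R ×ˢ P ↦ VWin w₀ P R`, `stair X w₀ ρ P ↦ VStair w₀ P ρ`, `y.2 ↦ φ y`, `col x := φ⁻¹(cen x)`;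
between-box and far box are the NARROW ones (`BtwN`, `EfarN`, transverse `5r − 1`) so that every no-edge separation is an ℓ^∞-gap ≥ 2 and
lifts by `lip` alone.  THREE generic devices replace the product's "planar step at fixed fibre coordinate":
(1) spans — `RunGeom` for free (`exists_adj_of_mem_VWin`); (2) the STEP DEVICE — a vertex of depth `≤ R − 1` over `P` with a planar unit
neighbour in `P` lies in `VWin P R` (field (ι) `step`), which proves every UNION containment of the records at the price of ONE unit of fibre
slack per containment (`WFS`: `ρ + 1 ≤ rQ` on the base rows, `ρ + 1 ≤ rE`, `rE + 1 ≤ rB`, `rE + 1 ≤ rQ'`, `rB + 1 ≤ rC`); (3) the LEVEL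
SHIFT — `L j := 5r + 10sj − 1`, `ℓQ := 5r + 1` (`levelDataS`; both are instance data of `LevelData`): an inside edge from level `≤ L j` stays in
the planar stub `H^j` and an inside edge from level `≥ 5r + 2` stays in `EfarN`, so `mem_Stub`, `mem_Face`, `Face_far`, `lev_Hfull` hold for spans.
* `prof`, `cellGeomSG`, `faceDataSG`, `levelDataS`; `WFS C Λ` (= p3's `ConcRadiiG.WF C` + the five slack families + the column radius);
* **`runGeomSG`, `anchGeomSG`, `sepGeomSG`, `sepGeom₂SG`** here; **`exitGeomSG`, `stepsGeomSG`, `levelGeomSG`, `qSepGeomSG`** in the companion file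
  `SkelCellsConcGLevels` (400-line rule).
Hypotheses beyond the structure: `WFS C Λ` and `Φ.φ w₀ = 0` (the root's footprint is the centre of the macro-origin; WLOG by translating `φ`).
[cite: KozmaNitzan2024, §4 pp. 25–27, 30–31 (Q_v, M_v, E_{v,x}, H^j_{v,x}, F^j_{v,x}) — the ℤ^d model] [cite: GrimmettPercolation1999, §7.2]
-/

noncomputable section

open scoped Classical

namespace Summit.CriticalPhenomena.PercolationContinuityZ3.Theorems

namespace Transplant

namespace PlanarSkeletonConc

open Literature.Probability.Percolation Literature.Probability.LatticeModels SimpleGraph KNCells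
open Literature.Probability.Percolation.KozmaNitzan.Cells (oth oth_ne sgOf sgOf_sign stepVec_apply_fst stepVec_apply_oth eq_oth_of_ne oth_oth)
open Literature.Barriers.CriticalPhenomena (graphBall graphBall_finite mem_graphBall_self graphBall_mono)
open BoxProdZ2 (ConcRadiiG)

variable {V : Type} [DecidableEq V] {G : SimpleGraph V} [G.LocallyFinite] (Φ : PlanarSkeletonConc G)

/-! ## §1 Planar supplements: unit steps as `Pi.single`, self-adjacency of the remaining boxes -/

omit Φ in
/-- A `ℤ²`-edge is a unit step `± e_i`. [folklore] -/
theorem exists_single_of_zdAdj {t t' : Site 2} (h : (zdGraph 2).Adj t t') : ∃ (i : Fin 2) (σ : ℤˣ), t' = t + Pi.single i (σ : ℤ) := by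
  obtain ⟨i, h | h⟩ := (zdGraph_adj_iff t t').1 h
  · exact ⟨i, 1, by rw [h]; simp⟩
  · refine ⟨i, -1, ?_⟩
    rw [h]; ext j; by_cases hj : j = i
    · subst hj; simp
    · simp [hj]

/-- **The step device, `ℤ²`-adjacency form**: a vertex of depth `≤ n`, `n + 1 ≤ R`, footprint in `P`, with a `ℤ²`-neighbour of its footprint
in `P`, lies in `VWin P R`. [this work] -/
theorem mem_VWin_of_zdAdj {w₀ : V} {P : Finset (Site 2)} {R n : ℕ} {y : V} (hy : y ∈ graphBall G w₀ n) (hn : n + 1 ≤ R)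
    (hP : Φ.φ y ∈ P) (hself : ∃ t' ∈ P, (zdGraph 2).Adj (Φ.φ y) t') : y ∈ Φ.VWin w₀ P R := by
  obtain ⟨t', ht', hadj⟩ := hself
  obtain ⟨i, σ, rfl⟩ := exists_single_of_zdAdj hadj
  exact mem_VWin_of_step hy hn hP ht'

omit Φ in
/-- Self-adjacency of the cell `cen v + [-10r, 10r]²`. [folklore] -/
theorem _root_.Summit.CriticalPhenomena.PercolationContinuityZ3.Theorems.Transplant.PCells.exists_adj_of_mem_Cell (C : PCells) (v : Site 2)
    {t : Site 2} (ht : t ∈ C.Cell v) : ∃ t' ∈ C.Cell v, (zdGraph 2).Adj t t' :=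
  PCells.exists_adj_of_mem_Icc 0 (by simp only [Pi.sub_apply, Pi.add_apply, Pi.natCast_apply]; push_cast; have := C.one_le_r; omega) ht

omit Φ in
/-- Self-adjacency of the stub zone (transverse side `4r ≥ 1`). [folklore] -/
theorem _root_.Summit.CriticalPhenomena.PercolationContinuityZ3.Theorems.Transplant.PCells.exists_adj_of_mem_Zone (C : PCells) (v : Site 2)
    (δ : MDir) {t : Site 2} (ht : t ∈ C.Zone v δ) : ∃ t' ∈ C.Zone v δ, (zdGraph 2).Adj t t' := by
  unfold PCells.Zone KozmaNitzan.sBox at ht ⊢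
  refine PCells.exists_adj_of_mem_Icc (oth δ.1) ?_ ht
  simp only [KozmaNitzan.sLo, KozmaNitzan.sHi, if_neg (oth_ne δ.1)]
  have := C.one_le_r; omega

omit Φ in
/-- Self-adjacency of the narrow far box (transverse side `2(5r - 1) ≥ 1`). [folklore] -/
theorem _root_.Summit.CriticalPhenomena.PercolationContinuityZ3.Theorems.Transplant.PCells.exists_adj_of_mem_EfarN (C : PCells) (v : Site 2)
    (δ : MDir) {t : Site 2} (ht : t ∈ C.EfarN v δ) : ∃ t' ∈ C.EfarN v δ, (zdGraph 2).Adj t t' := by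
  unfold PCells.EfarN KozmaNitzan.sBox at ht ⊢
  refine PCells.exists_adj_of_mem_Icc (oth δ.1) ?_ ht
  simp only [KozmaNitzan.sLo, KozmaNitzan.sHi, if_neg (oth_ne δ.1)]
  have := C.one_le_r; omega

omit Φ in
/-- A stub point of level `≥ 5r + 1` lies in the narrow far box (`j ≤ K`; transverse `2r ≤ 5r − 1`, top level `5r + 10sK = 15r ≤ 25r`). [folklore] -/
theorem _root_.Summit.CriticalPhenomena.PercolationContinuityZ3.Theorems.Transplant.PCells.mem_EfarN_of_mem_Stub (C : PCells) {v : Site 2}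
    {δ : MDir} {j : ℕ} (hj : j ≤ C.K) {t : Site 2} (ht : t ∈ C.Stub v δ j) (hl : 5 * (C.r : ℤ) + 1 ≤ C.lev δ v t) : t ∈ C.EfarN v δ := by
  rw [PCells.Stub, PCells.mem_psBox_iff] at ht
  obtain ⟨⟨_, h2⟩, h3, h4⟩ := ht
  have hrK : (C.r : ℤ) = C.K * C.s := by simp [PCells.r]
  have hjK : (j : ℤ) ≤ C.K := by exact_mod_cast hj
  have hs1 : (1 : ℤ) ≤ C.s := by exact_mod_cast C.hs
  have hr1 : (1 : ℤ) ≤ C.r := by exact_mod_cast C.one_le_r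
  have hb : 10 * (C.s : ℤ) * j ≤ 10 * C.s * C.K := mul_le_mul_of_nonneg_left hjK (by positivity)
  unfold PCells.lev at hl
  rw [PCells.EfarN, PCells.mem_psBox_iff]
  exact ⟨⟨hl, by nlinarith⟩, by omega, by omega⟩

omit Φ in
/-- `e₀ ∈ Q_0` (`5r ≥ 1`). [folklore] -/
theorem _root_.Summit.CriticalPhenomena.PercolationContinuityZ3.Theorems.Transplant.PCells.single_mem_Q_zero (C : PCells) :
    (0 : Site 2) + Pi.single (0 : Fin 2) ((1 : ℤˣ) : ℤ) ∈ C.Q 0 := by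
  rw [PCells.Q, PCells.mem_sq_iff]
  have := C.one_le_r
  intro i
  fin_cases i
  · simp; omega
  · simp

omit Φ in
/-- `cen x + e₀ ∈ Q_x` (`5r ≥ 1`). [folklore] -/
theorem _root_.Summit.CriticalPhenomena.PercolationContinuityZ3.Theorems.Transplant.PCells.cen_add_single_mem_Q (C : PCells) (x : Site 2) :
    C.cen x + Pi.single (0 : Fin 2) ((1 : ℤˣ) : ℤ) ∈ C.Q x := by
  rw [PCells.Q, PCells.mem_sq_iff]
  have := C.one_le_r
  intro i
  fin_cases i
  · simp; omega
  · simp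

end PlanarSkeletonConc

/-! Generic-layer declarations live in `Transplant.Skel` with `Φ` explicit (p3-g4's namespace ruling 18:18:52Z (3)). -/
namespace Skel

open Literature.Probability.Percolation Literature.Probability.LatticeModels SimpleGraph KNCells PlanarSkeletonConc
open Literature.Probability.Percolation.KozmaNitzan.Cells (oth oth_ne sgOf sgOf_sign stepVec_apply_fst stepVec_apply_oth eq_oth_of_ne oth_oth)
open Literature.Barriers.CriticalPhenomena (graphBall graphBall_finite mem_graphBall_self graphBall_mono)
open BoxProdZ2 (ConcRadiiG)

variable {V : Type} [DecidableEq V] {G : SimpleGraph V} [G.LocallyFinite] (Φ : PlanarSkeletonConc G)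

/-! ## §2 The cell geometry of record over window spans -/

/-- The corridor profile as a planar function (fibre depth allowed at planar level `lev δ v t`). [this work] -/
def prof (C : PCells) (Λ : ConcRadiiG) (a : ℕ) (v : Site 2) (δ : MDir) : Site 2 → ℕ := fun t => Λ.ρ a v δ (C.lev δ v t)

/-- **The concentric cell geometry over a planar skeleton** (anchor type `ℕ` = depth, anchor rule `a ↦ a + 1`, admissible `{a, a+1}`): every
region is the vertex span of a coordinate-free window over Kozma–Nitzan's planar box, with p3's general radius schedule; between / far boxes are the
narrow ones. [cite: KozmaNitzan2024, §4 pp. 25–26 (Q_v, M_v, E_{v,x}, H^j_{v,x})] -/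
def cellGeomSG (C : PCells) (w₀ : V) (Λ : ConcRadiiG) : CellGeom V ℕ where
  K := C.K
  root := w₀
  a₀ := 0
  Q := fun a v => Φ.VWin w₀ (C.Q v) (Λ.rQ a v)
  M := fun a v => Φ.VWin w₀ (C.M v) (Λ.rM a v)
  Cell := fun a v => Φ.VWin w₀ (C.Cell v) (Λ.rC a v)
  Btw := fun a v δ => Φ.VWin w₀ (C.BtwN v δ) (Λ.rB a v δ)
  Efar := fun a v δ => Φ.VWin w₀ (C.EfarN v δ) (Λ.rE a v δ)
  Stub := fun a v δ j => Φ.VStair w₀ (C.Stub v δ j) (prof C Λ a v δ)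
  Zone := fun a v δ => Φ.VWin w₀ (C.Zone v δ) (Λ.rB a v δ)
  col := fun x => {y | Φ.φ y = C.cen x}
  anchor := fun a _ _ => a + 1
  anchSet := fun a _ => {a, a + 1}
  anchor_mem := fun a _ _ => Finset.mem_insert_of_mem (Finset.mem_singleton_self _)
  stub_mono := fun _ v δ _ _ h => VStair_mono (C.Stub_mono v δ h) fun _ _ => le_rfl
  hK := by have := C.hK; omega

/-- **Faces and corridors**: the corridor is the span of the staircase window over `H_{v,δ}`; the face of level `j` is the part of the stub span
at planar level `L j = 5r + 10sj − 1` (ONE ROW BELOW the planar face — the level shift). [cite: KozmaNitzan2024, §4 p. 26 (H_{v,x}), p. 30 (F^j_{v,x})] -/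
def faceDataSG (C : PCells) (w₀ : V) (Λ : ConcRadiiG) : FaceData V ℕ where
  Face := fun a v δ j => (Φ.VStair w₀ (C.Stub v δ j) (prof C Λ a v δ)).filter fun y =>
    C.lev δ v (Φ.φ y) = 5 * (C.r : ℤ) + 10 * (C.s : ℤ) * j - 1
  Hfull := fun a v δ => Φ.VStair w₀ (C.Hfull v δ) (prof C Λ a v δ)

/-- **Level data** with the level shift: `lev = planar level of the footprint`, `L j = 5r + 10sj − 1`, `ℓQ = 5r + 1`. [this work] -/
def levelDataS (C : PCells) : LevelData V ℕ where
  lev := fun _ v δ y => C.lev δ v (Φ.φ y)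
  L := fun j => 5 * (C.r : ℤ) + 10 * (C.s : ℤ) * j - 1
  ℓQ := 5 * (C.r : ℤ) + 1

omit Φ in
/-- **Well-formedness with slack**: p3's eight order families `ConcRadiiG.WF` plus ONE UNIT of fibre slack at each union containment and the
column radius (the price of the step device; every instance schedule has gaps `≫ 1`). [this work] -/
structure WFS (C : PCells) (Λ : ConcRadiiG) : Prop where
  wf : Λ.WF C
  /-- `BtwN_{a'} ⊆ Cell_a ∪ …` with slack -/
  BC1 : ∀ a a' v δ, a' ∈ ({a, a + 1} : Finset ℕ) → Λ.rB a' v δ + 1 ≤ Λ.rC a v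
  /-- `BtwN_a ⊆ … ∪ Cell_{a'}(v + δ)` with slack -/
  BC1' : ∀ a a' v δ, a' ∈ ({a, a + 1} : Finset ℕ) → Λ.rB a v δ + 1 ≤ Λ.rC a' (v + stepVec δ)
  /-- base rows of the corridor sets inside the cube, with slack -/
  ρQ1 : ∀ a a' v δ ℓ, a' ∈ ({a, a + 1} : Finset ℕ) → ℓ ≤ 5 * (C.r : ℤ) → Λ.ρ a' v δ ℓ + 1 ≤ Λ.rQ a v
  /-- corridor profile inside the far box, with slack -/
  ρE1 : ∀ a v δ ℓ, Λ.ρ a v δ ℓ + 1 ≤ Λ.rE a v δ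
  /-- far box inside the between-box, with slack -/
  EB1 : ∀ a v δ, Λ.rE a v δ + 1 ≤ Λ.rB a v δ
  /-- far box inside the next cube, with slack -/
  EQ1 : ∀ a v δ, Λ.rE a v δ + 1 ≤ Λ.rQ a (v + stepVec δ)
  /-- the column point of `x` inside `Q_a x`: the cube's radius dominates the planar ℓ¹-offset of `cen x` -/
  colQ : ∀ a x, (C.cen x 0).natAbs + (C.cen x 1).natAbs + 1 ≤ Λ.rQ a x

namespace WFS

variable {C : PCells} {Λ : ConcRadiiG} (hΛ : WFS C Λ)
include hΛ

/-- `ρ + 1 ≤ rB`. [folklore] -/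
theorem ρB1 (a : ℕ) (v : Site 2) (δ : MDir) (ℓ : ℤ) : Λ.ρ a v δ ℓ + 1 ≤ Λ.rB a v δ :=
  (hΛ.ρE1 a v δ ℓ).trans ((Nat.le_succ _).trans (hΛ.EB1 a v δ))

/-- `ρ_{a'} + 1 ≤ rC_a` for an admissible `a'`. [folklore] -/
theorem ρC1 {a a' : ℕ} (v : Site 2) (δ : MDir) (ℓ : ℤ) (h : a' ∈ ({a, a + 1} : Finset ℕ)) : Λ.ρ a' v δ ℓ + 1 ≤ Λ.rC a v :=
  (hΛ.ρB1 a' v δ ℓ).trans (hΛ.wf.BC a a' v δ h)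

/-- `1 ≤ rQ 0 0` (column radius at the macro-origin). [folklore] -/
theorem one_le_rQ_zero : 1 ≤ Λ.rQ 0 0 := le_trans (by omega) (hΛ.colQ 0 0)

end WFS

section Records

variable (C : PCells) (w₀ : V) {Λ : ConcRadiiG} (hΛ : WFS C Λ) (hφ : Φ.φ w₀ = 0)

/-! ## §3 `RunGeom`, `AnchGeom` -/

/-- **`RunGeom` — automatic for spans.** [folklore] -/
theorem runGeomSG : RunGeom G (cellGeomSG Φ C w₀ Λ) where
  adjQ _ _ _ hy := exists_adj_of_mem_VWin hy
  adjBtw _ _ _ _ hy := exists_adj_of_mem_VWin hy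
  adjStub _ _ _ _ _ _ hy := exists_adj_of_mem_VStair hy

/-- `AnchGeom`. [folklore] -/
theorem anchGeomSG : AnchGeom (cellGeomSG Φ C w₀ Λ) where
  refl a _ := Finset.mem_insert_self a {a + 1}
  const _ _ _ := rfl

/-! ## §4 `SepGeom`, `SepGeom₂` -/

include hΛ hφ in
/-- **`SepGeom`** (containments by monotonicity or the step device, disjointness and columns planar). [cite: KozmaNitzan2024, §4 pp. 26–29] -/
theorem sepGeomSG : SepGeom G (cellGeomSG Φ C w₀ Λ) where
  anch_refl a _ := Finset.mem_insert_self a {a + 1}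
  root_mem := by
    change w₀ ∈ Φ.VWin w₀ (C.Q 0) (Λ.rQ 0 0)
    refine root_mem_VWin hΛ.one_le_rQ_zero (by rw [hφ]; exact C.zero_mem_Q_zero) (i := 0) (σ := 1) ?_
    rw [hφ]; exact C.single_mem_Q_zero
  Q_subset_Cell a v := VWin_mono (C.Q_subset_Cell v) (hΛ.wf.QC a a v (ConcRadiiG.WF.mem_self a))
  Btw_subset_Cells a a' v δ ha' := by
    intro y hy
    change y ∈ Φ.VWin w₀ (C.BtwN v δ) (Λ.rB a' v δ) at hy
    change y ∈ Φ.VWin w₀ (C.Cell v) (Λ.rC a v) ∪ Φ.VWin w₀ (C.Cell (v + stepVec δ)) (Λ.rC a' (v + stepVec δ))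
    have hd := mem_graphBall_of_mem_VWin hy
    rcases Finset.mem_union.1 (C.BtwN_subset_Cells v δ (φ_mem_of_mem_VWin hy)) with h | h
    · exact Finset.mem_union_left _ (Φ.mem_VWin_of_zdAdj hd (hΛ.BC1 a a' v δ ha') h (C.exists_adj_of_mem_Cell v h))
    · exact Finset.mem_union_right _
        (Φ.mem_VWin_of_zdAdj hd (hΛ.BC1' a' a' v δ (ConcRadiiG.WF.mem_self a')) h (C.exists_adj_of_mem_Cell _ h))
  Stub_subset_Q_union_Btw a a' v δ j ha' hj := by
    intro y hy
    change y ∈ Φ.VStair w₀ (C.Stub v δ j) (prof C Λ a' v δ) at hy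
    change y ∈ Φ.VWin w₀ (C.Q v) (Λ.rQ a v) ∪ Φ.VWin w₀ (C.BtwN v δ) (Λ.rB a' v δ)
    obtain ⟨hP, hd⟩ := mem_of_mem_VStair hy
    have hjK : j < C.K := by change j + 1 ≤ C.K at hj; omega
    rcases Finset.mem_union.1 (C.Stub_subset_Q_union_BtwN v δ hjK hP) with h | h
    · exact Finset.mem_union_left _
        (Φ.mem_VWin_of_zdAdj hd (hΛ.ρQ1 a a' v δ _ ha' (C.lev_le_of_mem_Q h)) h (C.exists_adj_of_mem_Q v h))
    · exact Finset.mem_union_right _ (Φ.mem_VWin_of_zdAdj hd (hΛ.ρB1 a' v δ _) h (C.exists_adj_of_mem_BtwN v δ h))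
  Stub_subset_Cell_union_Zone a a' v δ j ha' hj := by
    intro y hy
    change y ∈ Φ.VStair w₀ (C.Stub v δ j) (prof C Λ a' v δ) at hy
    change y ∈ Φ.VWin w₀ (C.Cell v) (Λ.rC a v) ∪ Φ.VWin w₀ (C.Zone v δ) (Λ.rB a' v δ)
    obtain ⟨hP, hd⟩ := mem_of_mem_VStair hy
    rcases Finset.mem_union.1 (C.Stub_subset_Cell_union_Zone v δ (by change j + 1 ≤ C.K at hj; omega) hP) with h | h
    · exact Finset.mem_union_left _ (Φ.mem_VWin_of_zdAdj hd (hΛ.ρC1 v δ _ ha') h (C.exists_adj_of_mem_Cell v h))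
    · exact Finset.mem_union_right _ (Φ.mem_VWin_of_zdAdj hd (hΛ.ρB1 a' v δ _) h (C.exists_adj_of_mem_Zone v δ h))
  Efar_subset_Btw_union_Q a v δ := by
    intro y hy
    change y ∈ Φ.VWin w₀ (C.EfarN v δ) (Λ.rE a v δ) at hy
    change y ∈ Φ.VWin w₀ (C.BtwN v δ) (Λ.rB a v δ) ∪ Φ.VWin w₀ (C.Q (v + stepVec δ)) (Λ.rQ a (v + stepVec δ))
    have hd := mem_graphBall_of_mem_VWin hy
    rcases Finset.mem_union.1 (C.EfarN_subset_BtwN_union_Q v δ (φ_mem_of_mem_VWin hy)) with h | h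
    · exact Finset.mem_union_left _ (Φ.mem_VWin_of_zdAdj hd (hΛ.EB1 a v δ) h (C.exists_adj_of_mem_BtwN v δ h))
    · exact Finset.mem_union_right _ (Φ.mem_VWin_of_zdAdj hd (hΛ.EQ1 a v δ) h (C.exists_adj_of_mem_Q _ h))
  Ewv_disjoint_Efar a a' w δw du hdu := by
    change Disjoint (Φ.VWin w₀ (C.BtwN w δw) (Λ.rB a w δw) ∪ Φ.VWin w₀ (C.Q (w + stepVec δw)) (Λ.rQ a (w + stepVec δw)))
      (Φ.VWin w₀ (C.EfarN (w + stepVec δw) du) (Λ.rE a' (w + stepVec δw) du))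
    have h := C.EwvN_disjoint_EfarN w hdu
    rw [PCells.EwvN, Finset.disjoint_union_left] at h
    rw [Finset.disjoint_union_left]
    exact ⟨disjoint_VWin h.1 _ _, disjoint_VWin h.2 _ _⟩
  Q_disjoint_Q a a' u x hux := disjoint_VWin (C.Q_disjoint_Q hux) _ _
  Q_disjoint_Btw a a' x v δ := disjoint_VWin (C.Q_disjoint_BtwN x v δ) _ _
  Btw_disjoint_Btw a a' v δ v' δ' h1 h2 := disjoint_VWin (C.BtwN_disjoint_BtwN h1 h2) _ _
  Q_disjoint_Efar a a' v δ := disjoint_VWin (C.Q_disjoint_EfarN v δ) _ _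
  Btw_disjoint_Efar a a' v δ δ' h := disjoint_VWin (C.BtwN_disjoint_EfarN v h) _ _
  col_Q a x := by
    change ∃ y ∈ Φ.VWin w₀ (C.Q x) (Λ.rQ a x), Φ.φ y = C.cen x
    refine exists_mem_VWin_φ_eq (C.cen_mem_Q x) (i := 0) (σ := 1) (C.cen_add_single_mem_Q x) ?_
    rw [hφ, Pi.zero_apply, Pi.zero_apply, sub_zero, sub_zero]; exact hΛ.colQ a x
  col_Cell a u x hux y hy hcol := by
    change Φ.φ y = C.cen x at hcol
    exact C.cen_not_mem_Cell hux (hcol ▸ φ_mem_of_mem_VWin hy)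
  col_Zone a u δ x y hy hcol := by
    change Φ.φ y = C.cen x at hcol
    exact C.cen_not_mem_Zone u δ x (hcol ▸ φ_mem_of_mem_VWin hy)

include hΛ hφ in
/-- **`SepGeom₂`** (cross-anchor containments). [cite: KozmaNitzan2024, §4 pp. 25–26] -/
theorem sepGeom₂SG : SepGeom₂ G (cellGeomSG Φ C w₀ Λ) where
  toSepGeom := sepGeomSG Φ C w₀ hΛ hφ
  Q_subset_Cell₂ a a' x ha' := VWin_mono (C.Q_subset_Cell x) (hΛ.wf.QC a a' x ha')
  Btw_subset_Cells₂ a a' v δ ha' := by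
    intro y hy
    change y ∈ Φ.VWin w₀ (C.BtwN v δ) (Λ.rB a v δ) at hy
    change y ∈ Φ.VWin w₀ (C.Cell v) (Λ.rC a v) ∪ Φ.VWin w₀ (C.Cell (v + stepVec δ)) (Λ.rC a' (v + stepVec δ))
    have hd := mem_graphBall_of_mem_VWin hy
    rcases Finset.mem_union.1 (C.BtwN_subset_Cells v δ (φ_mem_of_mem_VWin hy)) with h | h
    · exact Finset.mem_union_left _
        (Φ.mem_VWin_of_zdAdj hd (hΛ.BC1 a a v δ (ConcRadiiG.WF.mem_self a)) h (C.exists_adj_of_mem_Cell v h))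
    · exact Finset.mem_union_right _ (Φ.mem_VWin_of_zdAdj hd (hΛ.BC1' a a' v δ ha') h (C.exists_adj_of_mem_Cell _ h))

end Records

end Skel

end Transplant

end Summit.CriticalPhenomena.PercolationContinuityZ3.Theorems

end
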